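import Summits.Langlands.Langlands.Theorems.AbelianSurfaceSerreSerreGSp4SurjectiveStubCompanions
import Literature.NumberTheory.GaloisRepresentations.CompatibleSystemSymplecticMembers
import HarnessLib

/-!
# Route `AbelianSurfaceSerre`, crux `SerreGSp4Surjective` (stmt-Langlands-17765), line
# `singer-type-evaporation`: stub 4b/7 `stub_companionsSymp` (skeleton v9) — the `ℓ`-adic
# companions are SYMPLECTIC with multiplier exactly `ε_ℓ⁻¹`

Skeleton v9 restores the landed Barnet-Lamb–Gee–Geraghty–Taylor Thm. 4.2.1 stub
(`stub_automorphyLifting`, p157628), which consumes an `ℓ`-adic companion that is symplectic with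
multiplier EXACTLY `ε_ℓ⁻¹ = cycInv ℓ`; the landed companions stub (`stub_companions`, p169675,
file `AbelianSurfaceSerreSerreGSp4SurjectiveStubCompanions`, imported for its glue lemmas) builds
the companions as the members `𝓡 ℓ ι_ℓ` of the weakly compatible system through the lift
(`BLGGT2014_thm551_compatibleSystem_rat_GL4`, p159229), and NO accepted fact gave the SIGN of their
self-duality.  This file re-runs that construction with the set `good` cut down to the primes of
the composite named fact vendored for this stub,

* `BellaicheChenevier2011_cor13_irreducibleSymplecticMembers_rat_GL4` (Literature file
  `Literature/NumberTheory/GaloisRepresentations/CompatibleSystemSymplecticMembers.lean`): for the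
  weakly compatible system through such an `r` there is a set `L₂` having a Dirichlet density
  `c > 0` at which EVERY member `𝓡 ℓ ι` is irreducible AND symplectic with multiplier `ε_ℓ⁻¹` —
  Bellaïche–Chenevier 2011 Cor. 1.3 (the sign of `r_{ℓ,ı'}(π')`, as recalled in BLGGT 2014 §2.1)
  for the RAESDC `π'` over the Galois totally real `F'` over which the lift is automorphic (BLGGT
  2014 Cor. 4.5.2), Patrikis–Taylor 2015 Thm. 1.7 (irreducibility of `r_{ℓ,ı'}(π')` on a set of
  positive density, all `ı'`), and the glue `𝓡 ℓ ι|_{G_{F'}} ≅ r_{ℓ,ı'}(π')`,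
  `𝓡 ℓ ι ≅ (𝓡 ℓ ι)^∨ ⊗ ε_ℓ⁻¹` (Chebotarev, Brauer–Nesbitt), uniqueness of the `Γ_ℚ`-pairing and of
  the `G_{F'}`-pairing (Schur) — printed statements and the step-by-step derivation in that file's
  module docstring.  BOTH conclusions come on ONE set (two positive-density sets may be disjoint);
  the fact implies the Patrikis–Taylor fact p169196 that served v8's `stub_companions`, which is
  therefore no longer an antecedent,

besides the two accepted BLGGT facts of the registered signature:

* `BLGGT2014_thm551_compatibleSystem_rat_GL4` (p159229): the lift `L.lift` of an
  `OrdinaryLift p ρ̄`, `p ≥ 11`, `ρ̄` irreducible on `Γ_{ℚ(ζ_p)}` — symplectic with multiplier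
  `ε_p⁻¹` (`cycInv p` IS the fact's multiplier function, definitionally), unramified a.e., four
  distinct labelled weights `L.wts`, de Rham with `N = 0` and an invariant full flag at `p`,
  reducing to `ρ̄` — is the `(p, ι₀)`-member of a weakly compatible system `𝓡` of weight `L.wts`;
* `BLGGT2014_prop532_residuallyIrreducible_densityOne` (p158720): a density-one set `L₁` of primes
  at which the irreducible members are residually irreducible on `Γ_{ℚ(ζ_ℓ)}`.

Construction (as in p169675): `good := L₁ ∩ L₂ ∩ {ℓ : the place of ℓ is not in S}`,
`companion ℓ := 𝓡 ℓ ι_ℓ` for one chosen `ι_ℓ : ℚ̄_ℓ ≃ ℂ`; crystalline with labelled weights `wts`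
at `ℓ` from the system (`ℓ`'s place `∉ S`); `CompanionAE` through `ι := ι' ∘ ι_ℓ⁻¹ ∘ ι₀` and the
uniqueness of Frobenius polynomials (`hasFrobCharpolyAt_unique`, `arithFrobPolyOfSatake_map`);
irreducible AND symplectic-`ε_ℓ⁻¹` from `L₂`; residually rigid from `L₁`; `good` unbounded because
`L₁ ∩ L₂` has the density `c > 0` of `L₂` (`hasDirichletDensity_inter_of_one`) and only finitely
many primes lie in a place of `S` (`exists_bound_natCast_mem_asIdeal`).  `p₂ = 11`.

Main theorems: `exists_singerFamily_symplectic` (hypotheses explicit; the family together with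
the symplecticity of all its companions), `stub_companionsSymp_of`, and `stub_companionsSymp` —
the registered v9 signature WITH the vendored fact as a THIRD antecedent (the registered form,
with the two BLGGT antecedents only, is not provable from accepted content: neither gives the
sign; to be re-registered in this form).  The v8 stub follows too:
`stub_companions_of h551 h532 hBC.irreducibleMembers` (the composite fact projects onto the
Patrikis–Taylor fact p169196, `….irreducibleMembers` in its file).

References: BarnetlambEtAl2014 Thm. 5.5.1, Prop. 5.3.2, Cor. 4.5.2, §2.1, §5.1;
BellaicheChenevier2011 Cor. 1.3; PatrikisTaylor2014 Thm. 1.7; NeukirchANT1999 VII (13.1).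
-/

set_option linter.dupNamespace false -- `Summit.Langlands.Langlands` is the mandated namespace

namespace Summit.Langlands.Langlands.Cruxes.SerreGSp4Surjective.SingerTypeEvaporation

open Literature.NumberTheory.GaloisRepresentations Literature.NumberTheory.Automorphic
  Literature.NumberTheory.PAdicHodge Literature.NumberTheory.LFunctions
open scoped NumberField
open IsDedekindDomain Polynomial Filter

noncomputable section

/-- **The family with symplectic companions, hypotheses explicit.**  For `p ≥ 11`, `ρ̄`
irreducible on `Γ_{ℚ(ζ_p)}` and an `OrdinaryLift L`, there is a `SingerFamily` over `L` all of
whose companions are symplectic with multiplier exactly `ε_ℓ⁻¹` (`cycInv ℓ`): the construction of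
the landed `stub_companions_of` (p169675) with `good` restricted to the positive-density set of
`BellaicheChenevier2011_cor13_irreducibleSymplecticMembers_rat_GL4`, off which both
`companion_irreducible` and the symplecticity are read (module docstring).
[cite: BarnetlambEtAl2014, Thm. 5.5.1, Prop. 5.3.2 and Cor. 4.5.2]
[cite: BellaicheChenevier2011, Cor. 1.3] [cite: PatrikisTaylor2014, Thm. 1.7] -/
theorem exists_singerFamily_symplectic (h551 : BLGGT2014_thm551_compatibleSystem_rat_GL4)
    (h532 : BLGGT2014_prop532_residuallyIrreducible_densityOne)
    (hBC : BellaicheChenevier2011_cor13_irreducibleSymplecticMembers_rat_GL4)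
    {p : ℕ} [Fact p.Prime] (hp : 11 ≤ p) {ρ : FramedGaloisRep ℚ (ZMod p) 4}
    (hirr : IrredOnCycKernel p ρ) (L : OrdinaryLift p ρ) :
    ∃ 𝓕 : SingerFamily p ρ, 𝓕.toOrdinaryLift = L ∧ ∀ (ℓ : ℕ) [Fact ℓ.Prime] (h : ℓ ∈ 𝓕.good),
      (𝓕.companion ℓ h).IsSymplecticWithMultiplierFun (cycInv ℓ) := by
  -- the `p`-adic hypothesis of BLGGT 5.5.1, second alternative (de Rham, `N = 0`, invariant flag)
  have hp_adic : ∀ (v : HeightOneSpectrum (𝓞 ℚ)) (hv : ((p : ℕ) : 𝓞 ℚ) ∈ v.asIdeal),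
      let D := fontainePstAdicCompletion v p hv
      (letI := D.algebra
       ∀ τ : v.adicCompletion ℚ →ₐ[ℚ_[p]] PadicAlgCl p,
        L.lift.labelledHodgeTateWeightsAt v D.algebra D.𝔅 τ.toRingHom = L.wts) ∧
      ((D.IsCrystallineFramed (L.lift.toLocal v) ∧
          ∃ a : ℤ, ∀ h ∈ L.wts, a ≤ h ∧ h ≤ a + ((p : ℤ) - 2)) ∨
        (D.IsDeRhamFramed (L.lift.toLocal v) ∧
          (∀ W, D.IsWeilDeligneOf (L.lift.toLocal v) W → W.N = 0) ∧
          ∃ g : GL (Fin 4) (PadicAlgCl p),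
            ∀ (σ : Field.absoluteGaloisGroup (v.adicCompletion ℚ)) (i j : Fin 4), j < i →
              ((g * L.lift.toLocal v σ * g⁻¹ : GL (Fin 4) (PadicAlgCl p)) :
                Matrix (Fin 4) (Fin 4) (PadicAlgCl p)) i j = 0)) := by
    intro v hv
    refine ⟨fun τ => (L.lift_crystalline v hv).2 τ,
      Or.inr ⟨(L.lift_potCrystalline v hv).1, (L.lift_potCrystalline v hv).2, ?_⟩⟩
    obtain ⟨g, ψ, -, htri, -⟩ := L.lift_ordinary v hv
    exact ⟨g, fun σ i j hji => htri σ i j hji⟩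
  obtain ⟨red, hred⟩ := L.lift_reducesTo
  -- the weakly compatible system through the lift (BLGGT 5.5.1)
  obtain ⟨S, Q, ι₀, 𝓡, hr, h𝓡, hfrobr, hfrob⟩ := h551.exists_member hp L.lift L.wts
    L.lift_unramified L.lift_symplectic L.wts_nodup L.wts_card hp_adic ρ red hred hirr
  -- irreducible AND symplectic-`ε_ℓ⁻¹` members on a set of positive density
  -- (Bellaïche–Chenevier sign + Patrikis–Taylor irreducibility over `F'`)
  obtain ⟨L₂, c, hc, hL₂, hgood₂⟩ := hBC p hp L.lift L.wts L.lift_unramified L.lift_symplectic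
    L.wts_nodup L.wts_card hp_adic (ZMod p) ρ red hred hirr S Q ι₀ 𝓡 hr h𝓡
  -- residual rigidity on a density-one set (BLGGT 5.3.2)
  obtain ⟨L₁, hL₁, hrig⟩ := h532 4 S Q L.wts 𝓡 h𝓡 L.wts_nodup
  obtain ⟨B, hB⟩ := exists_bound_natCast_mem_asIdeal S
  have hdens : HasDirichletDensity (L₁ ∩ L₂) c := hasDirichletDensity_inter_of_one hL₁ hL₂
  -- one `ι_ℓ : ℚ̄_ℓ ≃ ℂ` per prime
  obtain ⟨ιc⟩ : Nonempty (∀ (ℓ : ℕ) [Fact ℓ.Prime], PadicAlgCl ℓ ≃+* ℂ) :=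
    ⟨fun ℓ _ => Classical.choice (PadicAlgCl.nonempty_ringEquiv_complex ℓ)⟩
  refine ⟨{ toOrdinaryLift := L,
            good := {ℓ | ℓ ∈ L₁ ∧ ℓ ∈ L₂ ∧ ∀ v ∈ S, ((ℓ : ℕ) : 𝓞 ℚ) ∉ v.asIdeal},
            good_unbounded := fun N => ?_,
            companion := fun ℓ _ _ => 𝓡 ℓ (ιc ℓ),
            companion_crystalline := fun ℓ _ h v hv => ?_,
            companion_compatible := fun ℓ _ h ι' => ?_,
            companion_irreducible := fun ℓ _ h => (hgood₂ ℓ h.2.1 (ιc ℓ)).1,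
            companion_rigid := fun ℓ _ h k _ _ _ _ _ ρ' red' hred' =>
              hrig ℓ h.1 (ιc ℓ) (hgood₂ ℓ h.2.1 (ιc ℓ)).1 k ρ' red' hred' }, rfl,
    fun ℓ _ h => (hgood₂ ℓ h.2.1 (ιc ℓ)).2⟩
  · -- `good` is unbounded: positive density minus finitely many
    classical
    obtain ⟨ℓ, hℓ, ⟨hℓ₁, hℓ₂⟩, hgt⟩ :=
      PrimeSum.exists_gt_of_tendsto_pos (X := L₁ ∩ L₂) hc
        (by convert hasDirichletDensity_iff.mp hdens using 6) (max N B)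
    exact ⟨ℓ, hℓ, ⟨hℓ₁, hℓ₂, hB ℓ hℓ ((le_max_right _ _).trans_lt hgt)⟩,
      (le_max_left _ _).trans hgt.le⟩
  · -- crystalline at `ℓ` with labelled weights `wts`: the system, `ℓ`'s place not in `S`
    have hvS : v ∉ S := fun hvS => h.2.2 v hvS hv
    have hm := (h𝓡.member ℓ (ιc ℓ)).2.2 v hv
    exact ⟨hm.2.1 hvS, hm.2.2⟩
  · -- a companion of the lift: `ι := ι' ∘ ι_ℓ⁻¹ ∘ ι₀`
    refine ⟨(ι₀.trans (ιc ℓ).symm).trans ι', ?_⟩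
    have hS : ∀ᶠ v : HeightOneSpectrum (𝓞 ℚ) in cofinite, v ∉ S :=
      Filter.eventually_cofinite.mpr (S.finite_toSet.subset fun v hv => by simpa using hv)
    have hp0 : p ≠ 0 := (Fact.out : p.Prime).ne_zero
    have hℓ0 : ℓ ≠ 0 := (Fact.out : ℓ.Prime).ne_zero
    filter_upwards [hS, eventually_natCast_not_mem_asIdeal (K := ℚ) hp0,
      eventually_natCast_not_mem_asIdeal (K := ℚ) hℓ0] with v hvS hvp hvℓ
    obtain ⟨hur, hPr⟩ := hfrobr v hvS hvp
    obtain ⟨huℓ, hPℓ⟩ := hfrob ℓ (ιc ℓ) v hvS hvℓ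
    refine ⟨hur, huℓ, fun a ha => ?_⟩
    have heq := hasFrobCharpolyAt_unique ha hPℓ
    have key : arithFrobPolyOfSatake ((ι₀.trans (ιc ℓ).symm).trans ι') v.residueCard 4 a =
        (Q v).map (ι₀.symm : ℂ ≃+* PadicAlgCl p).toRingHom := by
      rw [← arithFrobPolyOfSatake_map ι' ((ι₀.trans (ιc ℓ).symm).trans ι')
        ((ιc ℓ).trans ι₀.symm).toRingHom (fun z => rfl), heq, Polynomial.map_map]
      congr 1
      ext z
      simp
    rw [key]
    exact hPr

/-- **Stub 4b/7 `stub_companionsSymp`, corrected form with the hypotheses explicit** (the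
registered v9 signature with ONE extra antecedent, the vendored
`BellaicheChenevier2011_cor13_irreducibleSymplecticMembers_rat_GL4`).  For `p ≥ 11`, `ρ̄`
irreducible on `Γ_{ℚ(ζ_p)}` and any `OrdinaryLift`, a `SingerFamily` exists all of whose
companions are symplectic with multiplier exactly `ε_ℓ⁻¹`; `p₂ = 11`.
[cite: BarnetlambEtAl2014, Thm. 5.5.1, Prop. 5.3.2 and Cor. 4.5.2]
[cite: BellaicheChenevier2011, Cor. 1.3] [cite: PatrikisTaylor2014, Thm. 1.7] -/
theorem stub_companionsSymp_of (h551 : BLGGT2014_thm551_compatibleSystem_rat_GL4)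
    (h532 : BLGGT2014_prop532_residuallyIrreducible_densityOne)
    (hBC : BellaicheChenevier2011_cor13_irreducibleSymplecticMembers_rat_GL4) :
    ∃ p₂ : ℕ, ∀ (p : ℕ) [Fact p.Prime], p₂ ≤ p → ∀ ρ : FramedGaloisRep ℚ (ZMod p) 4,
      IrredOnCycKernel p ρ → Nonempty (OrdinaryLift p ρ) →
        ∃ 𝓕 : SingerFamily p ρ, ∀ (ℓ : ℕ) [Fact ℓ.Prime] (h : ℓ ∈ 𝓕.good),
          (𝓕.companion ℓ h).IsSymplecticWithMultiplierFun (cycInv ℓ) := by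
  refine ⟨11, fun p _ hp ρ hirr ⟨L⟩ => ?_⟩
  obtain ⟨𝓕, -, hsymp⟩ := exists_singerFamily_symplectic h551 h532 hBC hp hirr L
  exact ⟨𝓕, hsymp⟩

/-- **Stub 4b/7 `stub_companionsSymp` — the registered v9 signature WITH the vendored fact as a
third antecedent** (the form the lead re-registers; `stub-misstated` w.r.t. skeleton v9, whose
signature had only the two BLGGT facts: the sign of the companions' pairing is served by
neither). [cite: BarnetlambEtAl2014, Thm. 5.5.1, Prop. 5.3.2 and Cor. 4.5.2]
[cite: BellaicheChenevier2011, Cor. 1.3] [cite: PatrikisTaylor2014, Thm. 1.7] -/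
theorem stub_companionsSymp :
    BLGGT2014_thm551_compatibleSystem_rat_GL4 → BLGGT2014_prop532_residuallyIrreducible_densityOne →
    BellaicheChenevier2011_cor13_irreducibleSymplecticMembers_rat_GL4 →
    ∃ p₂ : ℕ, ∀ (p : ℕ) [Fact p.Prime], p₂ ≤ p → ∀ ρ : FramedGaloisRep ℚ (ZMod p) 4,
      IrredOnCycKernel p ρ → Nonempty (OrdinaryLift p ρ) →
        ∃ 𝓕 : SingerFamily p ρ, ∀ (ℓ : ℕ) [Fact ℓ.Prime] (h : ℓ ∈ 𝓕.good),
          (𝓕.companion ℓ h).IsSymplecticWithMultiplierFun (cycInv ℓ) :=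
  fun h551 h532 hBC => stub_companionsSymp_of h551 h532 hBC

end

end Summit.Langlands.Langlands.Cruxes.SerreGSp4Surjective.SingerTypeEvaporation
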